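import Mathlib.AlgebraicGeometry.ResidueField
import Mathlib.CategoryTheory.Sites.LocallyBijective
import Mathlib.RingTheory.Spectrum.Prime.Basic
import Literature.AlgebraicGeometry.Motives.EtaleArtinSchreier
import Literature.AlgebraicGeometry.Motives.SheafExactOfSections
import Literature.RingTheory.Idempotents.ArtinSchreierIdempotents
import HarnessLib

/-!
# The Artin–Schreier sequence on `Y_ét` is left exact: `ι : ℤ/p → 𝔾ₐ` is a monomorphism and
# `ℤ/p →ι 𝔾ₐ →(F-1) 𝔾ₐ` is exact in the middle (Milne II 2.18 (c), proved)

Two of the three parts of the discharge of the named fact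
`Literature.AlgebraicGeometry.Motives.artinSchreier_shortExact` (`EtaleArtinSchreier.lean`,
Milne II Examples 2.18 (c): the Artin–Schreier sequence `0 → ℤ/p → 𝔾ₐ →(F-1) 𝔾ₐ → 0` is exact
on `Y_ét` for every scheme `Y` of characteristic `p`); the third (surjectivity of `F - 1`, the
Artin–Schreier étale covers) and the assembly are in `EtaleArtinSchreierShortExactProofs.lean`.
Everything here is proved, on Mathlib's carriers (`Scheme.Etale`, `constantSheaf`, `Sheaf`):

* `mono_artinSchreierι` — **`ι` is a monomorphism**: the presheaf map `k ↦ k · 1`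
  (`zmodConstToEtaleGa`) is locally injective (`isLocallyInjective_zmodConstToEtaleGa`: if
  `k · 1 = 0` on `U` with `k ≠ 0` in `ℤ/p` then `Γ(U, 𝓞_U) = 0`, so `U = ∅` is covered by the
  empty family), hence so is the induced map on the sheafification (Mathlib
  `isLocallyInjective_of_isLocallyInjective_of_isLocallySurjective_fac` with `toSheafify`), and
  locally injective morphisms of sheaves are mono;
* `exists_artinSchreierι_eq` — **sectionwise exactness**: a function `s ∈ Γ(U, 𝓞_U)` with
  `s^p = s` is `ι` of a section of the constant sheaf `ℤ/p` over the *same* `U`, namely of the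
  locally constant function equal to `k` on `D(e_k(s))`, where `e_k(s) = 1 - (s - k)^{p-1}` are the
  orthogonal idempotents of `ArtinSchreierIdempotents.lean` (the `D(e_k(s))` are pairwise disjoint
  — `e_l e_k = 0` — and cover `U` — at a point `x`, `s(x)^p = s(x)` in the residue field forces
  `s(x) = k ∈ 𝔽_p` and then `e_k(s)(x) = 1`); the constant sections `k` on the pieces glue in the
  sheaf `ℤ/p` (`exists_zmodConst_section_of_partition`, Mathlib `Presieve.isSheafFor_arrows_iff`
  for the Zariski cover `etOfOpensι`), and `ι` of the glued section agrees with `s` on each piece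
  (`s = k` on `D(e_k(s))` since `(s - k) e_k(s) = 0` and `e_k(s)` is a unit there);
* `artinSchreierComplex_exact` — **exactness in the middle** of `artinSchreierComplex Y p hp` in
  the abelian category `Sheaf Y.smallEtaleTopology Ab`, from the sectionwise statement by
  `sheaf_exact_of_sections` (`SheafExactOfSections.lean`, Milne II 2.15).

## References

* J. S. Milne, *Étale cohomology*, Princeton (reissue 2025; held copy, PDF pages): II Examples
  2.18 (c) (pp. 74–75: `(ℤ/pℤ)_X(U) = {a ∈ Γ(U, 𝓞_U) | a^p - a = 0}`), II Thm. 2.15 (pp. 70–71).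
  [Milne2025]

## Design notes

* `zmodConstSection V k` is the image of `k` under `P_{ℤ/p} → a P_{ℤ/p}` (Mathlib `toSheafify`);
  `ι` on it is `(k · 1)|_V` by `toSheafify_artinSchreierι` (`EtaleArtinSchreier.lean`).
* Destructing a `Presieve.ofArrows` membership introduces a local named `Y`; statements needing
  the scheme `Y` are pre-bound before `rintro … ⟨k⟩`.
* Mathlib searches: `Sheaf.mono_of_isLocallyInjective`, `Presieve.isSheafFor_arrows_iff`,
  `Presieve.IsSeparatedFor.ext`, `Scheme.basicOpen_mul`, `Scheme.basicOpen_zero`,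
  `Scheme.evaluation_ne_zero_iff_mem_basicOpen`, `RingedSpace.isUnit_res_basicOpen`,
  `Scheme.Opens.ι_image_top`, `RingHom.ext_zmod`. Nothing restated.
-/

universe u

open CategoryTheory Limits Opposite AlgebraicGeometry

noncomputable section

namespace Literature.AlgebraicGeometry.Motives

section MonoIota

variable (Y : Scheme.{u}) (p : ℕ) [Fact p.Prime] (hp : (p : Γ(Y, ⊤)) = 0)

/-- A scheme whose ring of global functions is trivial is empty. [folklore] -/
theorem isEmpty_of_subsingleton_Γtop (X : Scheme.{u}) [Subsingleton Γ(X, ⊤)] : IsEmpty X :=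
  haveI : IsEmpty (Spec Γ(X, ⊤)) := PrimeSpectrum.isEmpty_iff_subsingleton.2 ‹_›
  Function.isEmpty X.toSpecΓ.base

/-- If `k · 1 = 0` in `Γ(U, 𝓞_U)` for some `k ≠ 0` in `ℤ/p` (and `p = 0` on `Y`), then the étale
`Y`-scheme `U` is empty. [folklore] -/
theorem isEmpty_of_zmodToTop_eq_zero (U : Y.Etale) {k : ZMod p} (hk : k ≠ 0)
    (h : resTop U (zmodToTop Y p hp k) = 0) : IsEmpty U.left := by
  rcases subsingleton_or_nontrivial Γ(U.left, ⊤) with hU | hU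
  · exact isEmpty_of_subsingleton_Γtop U.left
  · exfalso
    haveI : CharP Γ(U.left, ⊤) p :=
      (CharP.charP_iff_prime_eq_zero Fact.out).2 (cast_eq_zero_etale hp U)
    obtain ⟨j, rfl⟩ := ZMod.intCast_surjective k
    rw [zmodToTop_intCast, map_intCast] at h
    exact hk ((ZMod.intCast_zmod_eq_zero_iff_dvd j p).2
      ((CharP.intCast_eq_zero_iff Γ(U.left, ⊤) p j).1 h))

/-- `k ↦ (k · 1)|_U` is locally injective on `Y_ét`: two distinct constants agree only over the
empty scheme, which is covered by the empty family. [folklore] -/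
theorem isLocallyInjective_zmodConstToEtaleGa :
    Presheaf.IsLocallyInjective Y.smallEtaleTopology (zmodConstToEtaleGa Y p hp) where
  equalizerSieve_mem {U} x y h := by
    by_cases hxy : x = y
    · subst hxy
      have : Presheaf.equalizerSieve x x = ⊤ := by ext V f; simp
      rw [this]
      exact GrothendieckTopology.top_mem _ _
    · have hne : x.down - y.down ≠ 0 := fun e => hxy (ULift.ext x y (sub_eq_zero.1 e))
      have h0 : resTop U.unop (zmodToTop Y p hp (x.down - y.down)) = 0 := by
        rw [map_sub, map_sub, sub_eq_zero]
        exact h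
      haveI := isEmpty_of_zmodToTop_eq_zero Y p hp U.unop hne h0
      exact GrothendieckTopology.superset_covering _ bot_le (bot_mem_smallEtaleTopology U.unop)

/-- **`ι : ℤ/p → 𝔾ₐ` is a monomorphism** of sheaves on `Y_ét` (Milne II 2.18 (c):
`(ℤ/pℤ)_X(U) = {a ∈ Γ(U, 𝓞_U) | a^p - a = 0}` is a subsheaf of `𝔾_a`).
[cite: Milne2025, II Examples 2.18 (c)] -/
theorem mono_artinSchreierι : Mono (artinSchreierι Y p hp) := by
  haveI := isLocallyInjective_zmodConstToEtaleGa Y p hp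
  haveI : Sheaf.IsLocallyInjective (artinSchreierι Y p hp) :=
    Presheaf.isLocallyInjective_of_isLocallyInjective_of_isLocallySurjective_fac
      Y.smallEtaleTopology (f₁ := toSheafify Y.smallEtaleTopology _) (zmodConstToEtaleGa Y p hp)
      (toSheafify_artinSchreierι Y p hp)
  exact Sheaf.mono_of_isLocallyInjective _

end MonoIota

/-! ### Constant sections of the constant sheaf `ℤ/p`, and gluing them along a clopen partition -/

section ConstSections

variable (Y : Scheme.{u}) (p : ℕ) [Fact p.Prime] (hp : (p : Γ(Y, ⊤)) = 0)

/-- The constant section `k` of the constant sheaf `ℤ/p` (the sheafification `a P_{ℤ/p}`) over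
`V ∈ Y_ét`: the image of `k` under `P_{ℤ/p} → a P_{ℤ/p}`. [folklore] -/
def zmodConstSection (V : Y.Etale) (k : ZMod p) :
    ((constantSheaf Y.smallEtaleTopology Ab.{u}).obj
      (AddCommGrpCat.of (ULift.{u} (ZMod p)))).obj.obj (op V) :=
  (toSheafify Y.smallEtaleTopology
    ((Functor.const (Y.Etale)ᵒᵖ).obj (AddCommGrpCat.of (ULift.{u} (ZMod p))))).app (op V)
      (ULift.up k)

/-- Constant sections restrict to constant sections. [folklore] -/
theorem map_zmodConstSection {V W : Y.Etale} (f : W ⟶ V) (k : ZMod p) :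
    ((constantSheaf Y.smallEtaleTopology Ab.{u}).obj
      (AddCommGrpCat.of (ULift.{u} (ZMod p)))).obj.map f.op (zmodConstSection Y p V k) =
        zmodConstSection Y p W k := by
  have h := (toSheafify Y.smallEtaleTopology
    ((Functor.const (Y.Etale)ᵒᵖ).obj (AddCommGrpCat.of (ULift.{u} (ZMod p))))).naturality f.op
  have h' := congrArg (fun φ => φ.hom (ULift.up k)) h
  exact h'.symm

/-- `ι` on the constant section `k` over `V` is `(k · 1)|_V`. [folklore] -/
theorem artinSchreierι_app_zmodConstSection (V : Y.Etale) (k : ZMod p) :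
    (artinSchreierι Y p hp).hom.app (op V) (zmodConstSection Y p V k) =
      resTop V (zmodToTop Y p hp k) := by
  have h := congrArg (fun η => η.app (op V) (ULift.up k)) (toSheafify_artinSchreierι Y p hp)
  exact h

/-- Sections of a sheaf on `Y_ét` over an object with empty underlying scheme form a
subsingleton (the empty family covers). [folklore] -/
theorem subsingleton_sections_of_isEmpty (F : Sheaf Y.smallEtaleTopology Ab.{u}) (V : Y.Etale)
    [IsEmpty V.left] : Subsingleton (F.obj.obj (op V)) := by
  have hF : Presieve.IsSheaf Y.smallEtaleTopology (F.obj ⋙ forget Ab.{u}) :=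
    (isSheaf_iff_isSheaf_of_type _ _).1
      ((sheafCompose Y.smallEtaleTopology (forget Ab.{u})).obj F).property
  have h := (hF (⊥ : Sieve V) (bot_mem_smallEtaleTopology V)).isSeparatedFor
  exact ⟨fun a b => h.ext fun W f hf => hf.elim⟩

variable {Y p}

/-- An étale `Y`-scheme mapping into two disjoint opens of `U` is empty. [folklore] -/
theorem isEmpty_of_maps_to_disjoint (U : Y.Etale) {W₁ W₂ : U.left.Opens} (h12 : W₁ ⊓ W₂ = ⊥)
    {Z : Y.Etale} (g₁ : Z ⟶ etOfOpens U W₁) (g₂ : Z ⟶ etOfOpens U W₂)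
    (h : g₁ ≫ etOfOpensι U W₁ = g₂ ≫ etOfOpensι U W₂) : IsEmpty Z.left := by
  refine ⟨fun z => ?_⟩
  have hl : g₁.left ≫ W₁.ι = g₂.left ≫ W₂.ι := congrArg (fun φ => φ.left) h
  have h1 : (g₁.left ≫ W₁.ι).base z ∈ W₁ := by
    change W₁.ι.base (g₁.left.base z) ∈ (W₁ : Set U.left)
    rw [← Scheme.Opens.range_ι W₁]
    exact ⟨_, rfl⟩
  have h2 : (g₂.left ≫ W₂.ι).base z ∈ W₂ := by
    change W₂.ι.base (g₂.left.base z) ∈ (W₂ : Set U.left)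
    rw [← Scheme.Opens.range_ι W₂]
    exact ⟨_, rfl⟩
  rw [hl] at h1
  have : (g₂.left ≫ W₂.ι).base z ∈ (W₁ ⊓ W₂ : U.left.Opens) := ⟨h1, h2⟩
  rw [h12] at this
  exact this

variable (Y p)

/-- **Gluing constant sections along a partition into opens**: if the opens `W k ⊆ U`,
`k ∈ ℤ/p`, are pairwise disjoint and cover `U`, there is a section of the constant sheaf `ℤ/p`
over `U` which is the constant `k` on `W k` (the locally constant function `k` on `W k`).
[folklore] -/
theorem exists_zmodConst_section_of_partition (U : Y.Etale) (W : ZMod p → U.left.Opens)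
    (hdisj : ∀ k l, k ≠ l → W k ⊓ W l = ⊥) (hcov : ∀ x : U.left, ∃ k, x ∈ W k) :
    ∃ t : ((constantSheaf Y.smallEtaleTopology Ab.{u}).obj
        (AddCommGrpCat.of (ULift.{u} (ZMod p)))).obj.obj (op U),
      ∀ k, ((constantSheaf Y.smallEtaleTopology Ab.{u}).obj
        (AddCommGrpCat.of (ULift.{u} (ZMod p)))).obj.map (etOfOpensι U (W k)).op t =
          zmodConstSection Y p (etOfOpens U (W k)) k := by
  set X₁ := (constantSheaf Y.smallEtaleTopology Ab.{u}).obj (AddCommGrpCat.of (ULift.{u} (ZMod p)))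
  have hF : Presieve.IsSheaf Y.smallEtaleTopology (X₁.obj ⋙ forget Ab.{u}) :=
    (isSheaf_iff_isSheaf_of_type _ _).1
      ((sheafCompose Y.smallEtaleTopology (forget Ab.{u})).obj X₁).property
  have hsf : (Presieve.ofArrows _ (fun k => etOfOpensι U (W k))).IsSheafFor
      (X₁.obj ⋙ forget Ab.{u}) := by
    rw [Presieve.isSheafFor_iff_generate]
    exact hF _ (ofArrows_etOfOpensι_mem U W hcov)
  have hcompat : Presieve.Arrows.Compatible (X₁.obj ⋙ forget Ab.{u}) (fun k => etOfOpensι U (W k))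
      (fun k => zmodConstSection Y p (etOfOpens U (W k)) k) := by
    intro i j Z gi gj hg
    change X₁.obj.map gi.op (zmodConstSection Y p _ i) = X₁.obj.map gj.op (zmodConstSection Y p _ j)
    rw [map_zmodConstSection, map_zmodConstSection]
    by_cases hij : i = j
    · rw [hij]
    · haveI := isEmpty_of_maps_to_disjoint U (hdisj i j hij) gi gj hg
      haveI := subsingleton_sections_of_isEmpty Y X₁ Z
      exact Subsingleton.elim _ _
  obtain ⟨t, ht, -⟩ := ((Presieve.isSheafFor_arrows_iff _ _).1 hsf) _ hcompat
  exact ⟨t, ht⟩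

end ConstSections

/-! ### Scheme-level lemmas: restriction to a basic open -/

section BasicOpen

variable {X : Scheme.{u}}

/-- A global function `e` is a unit on the basic open `D(e)` (as an open subscheme).
[folklore] -/
theorem isUnit_ι_appTop_basicOpen (e : Γ(X, ⊤)) : IsUnit ((X.basicOpen e).ι.appTop e) := by
  have h1 := X.toRingedSpace.isUnit_res_basicOpen e
  have h2 : (X.basicOpen e).ι ''ᵁ ⊤ ≤ X.toRingedSpace.basicOpen e :=
    le_of_eq (Scheme.Opens.ι_image_top _)
  have h3 := h1.map (X.presheaf.map (homOfLE h2).op).hom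
  rw [← CommRingCat.comp_apply, ← X.presheaf.map_comp] at h3
  exact h3

/-- If `(s - c) · e = 0` then `s = c` on `D(e)`. [folklore] -/
theorem ι_appTop_eq_of_sub_mul_eq_zero {s c e : Γ(X, ⊤)} (h : (s - c) * e = 0) :
    (X.basicOpen e).ι.appTop s = (X.basicOpen e).ι.appTop c := by
  have h' := congrArg ((X.basicOpen e).ι.appTop) h
  rw [map_mul, map_zero, map_sub] at h'
  exact sub_eq_zero.1 ((isUnit_ι_appTop_basicOpen e).mul_left_eq_zero.1 h')

end BasicOpen

/-! ### Exactness of the Artin–Schreier complex in the middle -/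

section ExactMiddle

variable (Y : Scheme.{u}) (p : ℕ) [hpr : Fact p.Prime] (hp : (p : Γ(Y, ⊤)) = 0)

/-- In a non-zero ring of functions `Γ(U, 𝓞_U)` of characteristic `p`, `(k · 1)|_U` is the image
of `k` under `ℤ/p → Γ(U, 𝓞_U)`. [folklore] -/
theorem resTop_zmodToTop_eq_castHom (U : Y.Etale) [CharP Γ(U.left, ⊤) p] (k : ZMod p) :
    resTop U (zmodToTop Y p hp k) = ZMod.castHom (dvd_refl p) Γ(U.left, ⊤) k := by
  obtain ⟨j, rfl⟩ := ZMod.intCast_surjective k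
  rw [zmodToTop_intCast, map_intCast, map_intCast]

/-- The `g`-map `F - 1` of the Artin–Schreier complex on sections: `s ↦ s ^ p - s` (by `rfl`).
[folklore] -/
theorem artinSchreierComplex_g_apply (U : (Y.Etale)ᵒᵖ) (s : Γ(U.unop.left, ⊤)) :
    (artinSchreierComplex Y p hp).g.hom.app U s = s ^ p - s := rfl

/-- **Sectionwise exactness of the Artin–Schreier complex**: a function `s ∈ Γ(U, 𝓞_U)` with
`s ^ p = s` is the image under `ι` of a section of the constant sheaf `ℤ/p` over `U` — namely of
the locally constant function equal to `k` on `D(e_k(s))`, `e_k(s) = 1 - (s - k)^{p-1}`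
(Milne II 2.18 (c): `(ℤ/pℤ)_X(U) = {a ∈ Γ(U, 𝓞_U) | a^p - a = 0}`).
[cite: Milne2025, II Examples 2.18 (c)] -/
theorem exists_artinSchreierι_eq (U : Y.Etale) (s : Γ(U.left, ⊤)) (hs : s ^ p = s) :
    ∃ t, (artinSchreierι Y p hp).hom.app (op U) t = s := by
  rcases subsingleton_or_nontrivial Γ(U.left, ⊤) with hU | hU
  · exact ⟨0, by rw [map_zero]; exact hU.elim _ _⟩
  haveI : CharP Γ(U.left, ⊤) p :=
    (CharP.charP_iff_prime_eq_zero hpr.out).2 (cast_eq_zero_etale hp U)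
  -- the idempotents and the opens they cut out
  set c : ZMod p → Γ(U.left, ⊤) := fun k => ZMod.castHom (dvd_refl p) Γ(U.left, ⊤) k with hc
  set e : ZMod p → Γ(U.left, ⊤) := fun k => 1 - (s - c k) ^ (p - 1) with he
  set W : ZMod p → U.left.Opens := fun k => U.left.basicOpen (e k) with hW
  have hdisj : ∀ k l, k ≠ l → W k ⊓ W l = ⊥ := by
    intro k l hkl
    rw [hW]
    change U.left.basicOpen (e k) ⊓ U.left.basicOpen (e l) = ⊥
    rw [← Scheme.basicOpen_mul, he]
    change U.left.basicOpen ((1 - (s - c k) ^ (p - 1)) * (1 - (s - c l) ^ (p - 1))) = ⊥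
    rw [Literature.RingTheory.Idempotents.artinSchreierIdem_mul_artinSchreierIdem_of_ne hs
      (Ne.symm hkl), Scheme.basicOpen_zero]
  have hcov : ∀ x : U.left, ∃ k, x ∈ W k := by
    intro x
    -- evaluate at the residue field of `x`
    set ev := (U.left.Γevaluation x).hom with hev
    haveI : CharP (U.left.residueField x) p := by
      refine (CharP.charP_iff_prime_eq_zero hpr.out).2 ?_
      have := congrArg ev (cast_eq_zero_etale hp U)
      rwa [map_natCast, map_zero] at this
    have hsx : ev s ^ p = ev s := by rw [← map_pow, hs]
    obtain ⟨k, hk⟩ := Literature.RingTheory.Idempotents.exists_eq_zmodCast_of_pow_eq_prime hsx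
    refine ⟨k, ?_⟩
    rw [hW]
    change (x : U.left) ∈ U.left.basicOpen (e k)
    rw [← U.left.evaluation_ne_zero_iff_mem_basicOpen (U := ⊤) x trivial]
    change ev (e k) ≠ 0
    have hck : ev (c k) = ZMod.castHom (dvd_refl p) (U.left.residueField x) k := by
      rw [hc]
      change (ev.comp (ZMod.castHom (dvd_refl p) Γ(U.left, ⊤))) k = _
      rw [RingHom.ext_zmod (ev.comp (ZMod.castHom (dvd_refl p) Γ(U.left, ⊤)))
        (ZMod.castHom (dvd_refl p) (U.left.residueField x))]
    have : ev (e k) = 1 := by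
      rw [he]
      change ev (1 - (s - c k) ^ (p - 1)) = 1
      rw [map_sub, map_one, map_pow, map_sub, hck, ← hk, sub_self, zero_pow, sub_zero]
      have := hpr.out.two_le
      omega
    rw [this]
    exact one_ne_zero
  -- glue the constant sections
  obtain ⟨t, ht⟩ := exists_zmodConst_section_of_partition Y p U W hdisj hcov
  refine ⟨t, ?_⟩
  -- compare `ι t` and `s` on each `W k`
  have hsep : (Presieve.ofArrows _ (fun k => etOfOpensι U (W k))).IsSeparatedFor
      ((etaleGa Y).obj ⋙ forget Ab.{u}) := by
    have hF : Presieve.IsSheaf Y.smallEtaleTopology ((etaleGa Y).obj ⋙ forget Ab.{u}) :=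
      (isSheaf_iff_isSheaf_of_type _ _).1
        ((sheafCompose Y.smallEtaleTopology (forget Ab.{u})).obj (etaleGa Y)).property
    rw [Presieve.isSeparatedFor_iff_generate]
    exact (hF _ (ofArrows_etOfOpensι_mem U W hcov)).isSeparatedFor
  -- (pre-bind everything mentioning `Y`: destructing `Presieve.ofArrows` below shadows the name)
  have key : ∀ k, (etaleGa Y).obj.map (etOfOpensι U (W k)).op
      ((artinSchreierι Y p hp).hom.app (op U) t) =
        (etaleGa Y).obj.map (etOfOpensι U (W k)).op s := by
    intro k
    have hnat := congrArg (fun φ => φ t)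
      (congrArg (fun φ => φ.hom) ((artinSchreierι Y p hp).hom.naturality (etOfOpensι U (W k)).op))
    simp only [AddCommGrpCat.hom_comp, AddMonoidHom.coe_comp, Function.comp_apply] at hnat
    rw [← hnat, ht k, artinSchreierι_app_zmodConstSection]
    -- both sides are restrictions to `W k = D(e k)`
    change (W k).ι.appTop (resTop U (zmodToTop Y p hp k)) = (W k).ι.appTop s
    rw [resTop_zmodToTop_eq_castHom]
    symm
    exact ι_appTop_eq_of_sub_mul_eq_zero
      (Literature.RingTheory.Idempotents.sub_zmodCast_mul_artinSchreierIdem hs k)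
  apply hsep.ext
  rintro V g ⟨k⟩
  exact key k

/-- **The Artin–Schreier complex is exact in the middle** (as a complex of sheaves on `Y_ét`):
sectionwise exactness (`exists_artinSchreierι_eq`) and `sheaf_exact_of_sections`.
[cite: Milne2025, II Examples 2.18 (c)] -/
theorem artinSchreierComplex_exact : (artinSchreierComplex Y p hp).Exact := by
  refine sheaf_exact_of_sections Y.smallEtaleTopology _ fun U (s : Γ(U.unop.left, ⊤)) hs => ?_
  have h0 : s ^ p - s = 0 := hs
  exact exists_artinSchreierι_eq Y p hp U.unop s (sub_eq_zero.1 h0)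

end ExactMiddle

end Literature.AlgebraicGeometry.Motives

end
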